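import Summits.Ventures.PercRepro.GenQTenEightGapType
import Summits.Ventures.PercRepro.GenQTenEightGapTrace

/-!
# PercRepro — THE `(10, 8)` ROW OF C-025 MODULO ITS PRECISE GAP (night-4, gen 19)
The two residues of `rls_ten_eight_of_finite_residues` discharged from GenQTenEightGapType (the type layer) and GenQTenEightGapTrace (the trace layer); `rls_ten_eight_of_residuals : HighLayersEightResidual → TraceSevenResidual → ∀ M, RLS M 10 8`.
-/
namespace PercRepro.Night4

open Finset ThmH SixFour GenQ PerFlat Star NightThree ThmN

variable {α : Type} [DecidableEq α] {M : Matroid α} [M.Finite]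

/-- **`TraceSevenResidue` holds**: Core → the seven hypotheses, then the trace module. -/
theorem traceSevenResidue_of_gap (hres : TraceSevenResidual) : TraceSevenResidue := by
  intro β _ M _ H hc hH hrH t ht1 ht7 hlo hhi
  have h10 := core_flat_four_le_ten M hc
  obtain ⟨hs, hline, hplane, hsolid, hflat5⟩ := coreHyps_of_core hc h10
  have hflat6 : ∀ F ∈ flatsQ M 6, F.card ≤ 43 := fun F hF => (card_le_fCore_of_core hc h10 6 F hF).trans (by decide)
  have hflat7 : ∀ F ∈ flatsQ M 7, F.card ≤ 87 := fun F hF => (card_le_fCore_of_core hc h10 7 F hF).trans (by decide)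
  exact traceSeven_residue_of_hyps_of_gap hres hs hline hplane hsolid hflat5 hflat6 hflat7 hc hH hrH t ht1 ht7 hlo hhi

/-- **THE `(10, 8)` ROW OF C-025 MODULO ITS PRECISE GAP**: `rls_ten_eight_of_finite_residues` on the two residues, each discharged from the
landed plain-row certificates plus the residual hypothesis on the gap lists of `GenQTenEightGap`. -/
theorem rls_ten_eight_of_residuals {γ : Type} [DecidableEq γ] (h1 : HighLayersEightResidual) (h2 : TraceSevenResidual) (M : Matroid γ) [M.Finite] : RLS M 10 8 :=
  rls_ten_eight_of_finite_residues (highLayersEightResidue_of_gap h1) (traceSevenResidue_of_gap h2) M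

end PercRepro.Night4
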